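import Mathlib.LinearAlgebra.Matrix.Determinant.Basic
import Mathlib.LinearAlgebra.Matrix.NonsingularInverse
import Mathlib.Algebra.Polynomial.Basic
import Mathlib.RingTheory.Polynomial.Basic
import Mathlib.NumberTheory.Padics.PadicNumbers
import Mathlib.Analysis.SpecialFunctions.Pow.Real
import Mathlib.Data.Int.ModEq
import Mathlib.Data.Set.Card
import Literature.NumberTheory.EllipticCurves.HeightFamily
import Literature.NumberTheory.EllipticCurves.Selmer
import HarnessLib

/-!
# Integral binary quartic forms, their invariants `I`, `J`, and the Bhargava–Shankar counting
# and parametrization theorems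

Topic `Literature/NumberTheory/EllipticCurves`. Vocabulary and named facts for the architecture
of the proof of Bhargava–Shankar's theorem "the average size of the `2`-Selmer group of elliptic
curves over `ℚ` is `3`" (`Literature.NumberTheory.EllipticCurves.average_card_selmerTwo`, `BSDSelmer.lean`; decomposition of the
named fact `Literature.NumberTheory.EllipticCurves.averageRankLE_three_halves`, `BSDWave0.lean`).

Source: M. Bhargava, A. Shankar, *Binary quartic forms having bounded invariants, and the
boundedness of the average rank of elliptic curves*, Ann. of Math. (2) 181 (2015) 191–242,
doi:10.4007/annals.2015.181.1.3. **Numbering caveat.** Theorem/section numbers below are those of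
the held arXiv text `arXiv:1006.1002v2` (June 2010; the version whose §3–4 treat monogenic cubic
fields and whose §5 treats `2`-Selmer groups); the published version (= arXiv v3, Dec. 2013)
reorganises the later sections (the Selmer material is its §3), so locators into §3–§5 are tagged
"arXiv:1006.1002v2 numbering". Theorems 1.1, 1.6 (= 2.1) and 1.7 are stated in §1.

## Contents

* `Literature.BinaryQuartic R`: binary quartic forms `f(x,y) = a x⁴ + b x³y + c x²y² + d xy³ + e y⁴`
  with coefficients in `R` (§2, p. 8: the space `V_R`), `eval`, `map`, `toPoly` (`f(x,1)`).
* The invariants `I(f) = 12ae − 3bd + c²`, `J(f) = 72ace + 9bcd − 27ad² − 27eb² − 2c³`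
  (§1.2 p. 4 and §2 p. 8), the discriminant `Δ(f) = (4I³ − J²)/27` (defined by its explicit
  integral sextic formula; `twentySeven_mul_disc`), and the height `H(f) = max(|I|³, J²/4)`
  (§2 p. 8).
* `subst f γ`: the substitution action `(γ · f)(x,y) = f((x,y)γ)` of `2 × 2` matrices (§2
  p. 8), with `eval_subst`, `subst_one`, `subst_mul` and the relative invariance
  `I(γ·f) = (det γ)⁴ I(f)`, `J(γ·f) = (det γ)⁶ J(f)` (§2 p. 8) — all proved.
* `GL2ZEquiv`: `GL₂(ℤ)`-equivalence of integral forms (an equivalence relation, proved);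
  `PGL2Equiv`: `PGL₂(K)`-equivalence for the twisted action `γ·f = det(γ)⁻² f((x,y)γ)`
  (§3.3 of the held text, p. 15, "twisted action"; an equivalence relation preserving `I` and
  `J` — `PGL2Equiv.refl/symm/trans/I_eq/J_eq`, proved); `IsSoluble`, `IsLocallySoluble`
  (§5.1: `z² = f(x,y)` soluble over `ℝ` and every `ℚ_p`); `IsIrreducible`; the real types
  `fourRealRoots`, `twoRealRoots`, `noRealRoots` (`V_ℤ^{(0)}, V_ℤ^{(1)}, V_ℤ^{(2)}`, §2.1);
  `gl2zClassCount S X = N(S; X)` (Thm 2.1).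
* Named facts: `bhargavaShankar_classCount` (Thm 1.6 = Thm 2.1: asymptotics of `N(V_ℤ^{(i)}; X)`),
  `bhargavaShankar_eligible_iff` (Thm 1.7: which `(I, J)` occur), and
  `bhargavaShankar_card_selmerTwo_eq` (Thm 5.6 of the held text: `#Sel₂(E_{A,B})` = number of
  `PGL₂(ℚ)`-classes of locally soluble integral quartics with invariants `2⁴I(E)`, `2⁶J(E)`,
  `I(E) = −3A`, `J(E) = −27B`).

## Design choices

* A `structure` with five fields, like Mathlib's `Cubic` (`Mathlib.Algebra.CubicDiscriminant`);
  Mathlib has no binary forms of degree `4` and no `I`, `J` invariants (searched `quartic`,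
  `BinaryForm`).
* Real types via discriminant sign and definiteness rather than by counting roots of `f(x,1)`:
  for forms with `Δ ≠ 0`, `Δ < 0` iff exactly two real roots in `ℙ¹(ℝ)`; `Δ > 0` iff four or no
  real roots, and "no real roots" iff `f` is definite (§2.1: "`V_ℝ^{(2)}` is the set of definite
  forms"). The counted forms are irreducible, hence have `Δ ≠ 0`.
* Irreducibility of the binary form over `ℚ` is `a ≠ 0 ∧ Irreducible f(x,1)` in `ℚ[X]`
  (a binary form of degree `4` with `a = 0` is divisible by `y`; for `a ≠ 0` factorisations of
  `f(x,y)` and of `f(x,1)` over `ℚ` correspond).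
* "Number of equivalence classes" of a set of forms is the `Set.ncard` of the set of orbits
  `{g | f ∼ g}`; "one-to-one correspondence" in Thm 5.6 is rendered as equality of cardinalities
  (`Nat.card` of the tree's cohomological `WeierstrassCurve.selmerGroup W 2`).
* `ζ(2)` is written `π²/6`.
-/

noncomputable section

open scoped Classical
open Polynomial

namespace Literature.NumberTheory.EllipticCurves

/-- A binary quartic form `f(x,y) = a x⁴ + b x³y + c x²y² + d xy³ + e y⁴` with coefficients in `R`
(an element of `V_R`; Bhargava–Shankar, Ann. of Math. 181 (2015), §2, p. 8).
[cite: BhargavaShankarAnnals2015, §2 (the space V_R)] -/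
@[ext]
structure BinaryQuartic (R : Type*) where
  /-- coefficient of `x⁴` -/
  a : R
  /-- coefficient of `x³y` -/
  b : R
  /-- coefficient of `x²y²` -/
  c : R
  /-- coefficient of `xy³` -/
  d : R
  /-- coefficient of `y⁴` -/
  e : R

namespace BinaryQuartic

section CommRing

variable {R S : Type*} [CommRing R] [CommRing S]

/-- The value `f(x,y) = a x⁴ + b x³y + c x²y² + d xy³ + e y⁴` (Bhargava–Shankar 2015, §2). [folklore] -/
def eval (f : BinaryQuartic R) (x y : R) : R :=
  f.a * x ^ 4 + f.b * x ^ 3 * y + f.c * x ^ 2 * y ^ 2 + f.d * x * y ^ 3 + f.e * y ^ 4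

/-- Change of coefficient ring along a ring homomorphism (e.g. `ℤ → ℚ`, `ℤ → ℝ`, `ℤ → ℚ_p`).
[folklore] -/
def map (φ : R →+* S) (f : BinaryQuartic R) : BinaryQuartic S :=
  ⟨φ f.a, φ f.b, φ f.c, φ f.d, φ f.e⟩

/-- `map` on the coefficient `a` (definitional). [folklore] -/
@[simp] theorem map_a (φ : R →+* S) (f : BinaryQuartic R) : (f.map φ).a = φ f.a := rfl
/-- `map` on the coefficient `b` (definitional). [folklore] -/
@[simp] theorem map_b (φ : R →+* S) (f : BinaryQuartic R) : (f.map φ).b = φ f.b := rfl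
/-- `map` on the coefficient `c` (definitional). [folklore] -/
@[simp] theorem map_c (φ : R →+* S) (f : BinaryQuartic R) : (f.map φ).c = φ f.c := rfl
/-- `map` on the coefficient `d` (definitional). [folklore] -/
@[simp] theorem map_d (φ : R →+* S) (f : BinaryQuartic R) : (f.map φ).d = φ f.d := rfl
/-- `map` on the coefficient `e` (definitional). [folklore] -/
@[simp] theorem map_e (φ : R →+* S) (f : BinaryQuartic R) : (f.map φ).e = φ f.e := rfl

/-- `map` commutes with evaluation (elementary). [folklore] -/
theorem eval_map (φ : R →+* S) (f : BinaryQuartic R) (x y : R) :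
    (f.map φ).eval (φ x) (φ y) = φ (f.eval x y) := by
  simp [eval, map]

/-- The dehomogenised polynomial `f(x,1) = a X⁴ + b X³ + c X² + d X + e ∈ R[X]`. [folklore] -/
def toPoly (f : BinaryQuartic R) : R[X] :=
  C f.a * X ^ 4 + C f.b * X ^ 3 + C f.c * X ^ 2 + C f.d * X + C f.e

/-- Scaling all coefficients: `(μ • f)(x,y) = μ f(x,y)`. [folklore] -/
instance : SMul R (BinaryQuartic R) :=
  ⟨fun μ f ↦ ⟨μ * f.a, μ * f.b, μ * f.c, μ * f.d, μ * f.e⟩⟩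

/-- Scaling on the coefficient `a` (definitional). [folklore] -/
@[simp] theorem smul_a (μ : R) (f : BinaryQuartic R) : (μ • f).a = μ * f.a := rfl
/-- Scaling on the coefficient `b` (definitional). [folklore] -/
@[simp] theorem smul_b (μ : R) (f : BinaryQuartic R) : (μ • f).b = μ * f.b := rfl
/-- Scaling on the coefficient `c` (definitional). [folklore] -/
@[simp] theorem smul_c (μ : R) (f : BinaryQuartic R) : (μ • f).c = μ * f.c := rfl
/-- Scaling on the coefficient `d` (definitional). [folklore] -/
@[simp] theorem smul_d (μ : R) (f : BinaryQuartic R) : (μ • f).d = μ * f.d := rfl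
/-- Scaling on the coefficient `e` (definitional). [folklore] -/
@[simp] theorem smul_e (μ : R) (f : BinaryQuartic R) : (μ • f).e = μ * f.e := rfl

/-- `(μ • f)(x,y) = μ · f(x,y)` (elementary). [folklore] -/
theorem eval_smul (μ : R) (f : BinaryQuartic R) (x y : R) :
    (μ • f).eval x y = μ * f.eval x y := by
  simp only [eval, smul_a, smul_b, smul_c, smul_d, smul_e]
  ring

/-- Scaling is a monoid action of `R` (elementary). [folklore] -/
instance : MulAction R (BinaryQuartic R) where
  one_smul f := by ext <;> simp
  mul_smul μ ν f := by ext <;> simp [mul_assoc]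

/-! ### The invariants `I`, `J`, the discriminant and the substitution action -/

/-- The degree-`2` invariant `I(f) = 12ae − 3bd + c²` (Bhargava–Shankar, Ann. of Math. 181 (2015),
§1.2 and §2 p. 8). [cite: BhargavaShankarAnnals2015, §2 p. 8] -/
def I (f : BinaryQuartic R) : R :=
  12 * f.a * f.e - 3 * f.b * f.d + f.c ^ 2

/-- The degree-`3` invariant `J(f) = 72ace + 9bcd − 27ad² − 27eb² − 2c³` (Bhargava–Shankar,
Ann. of Math. 181 (2015), §1.2 and §2 p. 8). [cite: BhargavaShankarAnnals2015, §2 p. 8] -/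
def J (f : BinaryQuartic R) : R :=
  72 * f.a * f.c * f.e + 9 * f.b * f.c * f.d - 27 * f.a * f.d ^ 2 - 27 * f.e * f.b ^ 2
    - 2 * f.c ^ 3

/-- The discriminant `Δ(f)` of a binary quartic form, given by its explicit integral formula
`256a³e³ − 192a²bde² − 128a²c²e² + 144a²cd²e − 27a²d⁴ + 144ab²ce² − 6ab²d²e − 80abc²de + 18abcd³
+ 16ac⁴e − 4ac³d² − 27b⁴e² + 18b³cde − 4b³d³ − 4b²c³e + b²c²d²`, so that `Δ = (4I³ − J²)/27`
(`twentySeven_mul_disc`; Bhargava–Shankar, Ann. of Math. 181 (2015), §1.2: `Δ(f) = (4I(f)³ −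
J(f)²)/27`). [cite: BhargavaShankarAnnals2015, §1.2 (discriminant formula)] -/
def disc (f : BinaryQuartic R) : R :=
  256 * f.a ^ 3 * f.e ^ 3 - 192 * f.a ^ 2 * f.b * f.d * f.e ^ 2 - 128 * f.a ^ 2 * f.c ^ 2 * f.e ^ 2
    + 144 * f.a ^ 2 * f.c * f.d ^ 2 * f.e - 27 * f.a ^ 2 * f.d ^ 4 + 144 * f.a * f.b ^ 2 * f.c * f.e ^ 2
    - 6 * f.a * f.b ^ 2 * f.d ^ 2 * f.e - 80 * f.a * f.b * f.c ^ 2 * f.d * f.e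
    + 18 * f.a * f.b * f.c * f.d ^ 3 + 16 * f.a * f.c ^ 4 * f.e - 4 * f.a * f.c ^ 3 * f.d ^ 2
    - 27 * f.b ^ 4 * f.e ^ 2 + 18 * f.b ^ 3 * f.c * f.d * f.e - 4 * f.b ^ 3 * f.d ^ 3
    - 4 * f.b ^ 2 * f.c ^ 3 * f.e + f.b ^ 2 * f.c ^ 2 * f.d ^ 2

/-- `27 Δ(f) = 4 I(f)³ − J(f)²` (Bhargava–Shankar, Ann. of Math. 181 (2015), §1.2 and §2).
[cite: BhargavaShankarAnnals2015, §2 (Δ(f) = (4I³(f) − J²(f))/27)] -/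
theorem twentySeven_mul_disc (f : BinaryQuartic R) : 27 * f.disc = 4 * f.I ^ 3 - f.J ^ 2 := by
  simp only [disc, I, J]
  ring

/-- `I` commutes with change of ring (elementary). [folklore] -/
@[simp] theorem I_map (φ : R →+* S) (f : BinaryQuartic R) : (f.map φ).I = φ f.I := by
  simp only [I, map, map_add, map_sub, map_mul, map_pow, map_ofNat]

/-- `J` commutes with change of ring (elementary). [folklore] -/
@[simp] theorem J_map (φ : R →+* S) (f : BinaryQuartic R) : (f.map φ).J = φ f.J := by
  simp only [J, map, map_add, map_sub, map_mul, map_pow, map_ofNat]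

/-- `Δ` commutes with change of ring (elementary). [folklore] -/
@[simp] theorem disc_map (φ : R →+* S) (f : BinaryQuartic R) : (f.map φ).disc = φ f.disc := by
  simp only [disc, map, map_add, map_sub, map_mul, map_pow, map_ofNat]

/-- The substitution action of a `2 × 2` matrix `γ = (p q; r s)`:
`(f.subst γ)(x,y) = f((x,y)γ) = f(px + ry, qx + sy)` (`eval_subst`), written out on coefficients
(Bhargava–Shankar, Ann. of Math. 181 (2015), §2 p. 8: `γ · f(x,y) = f((x,y)·γ)`, a left action:
`subst_mul`). [cite: BhargavaShankarAnnals2015, §2 p. 8] -/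
def subst (f : BinaryQuartic R) (γ : Matrix (Fin 2) (Fin 2) R) : BinaryQuartic R :=
  let p := γ 0 0; let q := γ 0 1; let r := γ 1 0; let s := γ 1 1
  ⟨f.a * p ^ 4 + f.b * p ^ 3 * q + f.c * p ^ 2 * q ^ 2 + f.d * p * q ^ 3 + f.e * q ^ 4,
    4 * f.a * p ^ 3 * r + f.b * p ^ 3 * s + 3 * f.b * p ^ 2 * q * r + 2 * f.c * p ^ 2 * q * s
      + 2 * f.c * p * q ^ 2 * r + 3 * f.d * p * q ^ 2 * s + f.d * q ^ 3 * r + 4 * f.e * q ^ 3 * s,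
    6 * f.a * p ^ 2 * r ^ 2 + 3 * f.b * p ^ 2 * r * s + 3 * f.b * p * q * r ^ 2 + f.c * p ^ 2 * s ^ 2
      + 4 * f.c * p * q * r * s + f.c * q ^ 2 * r ^ 2 + 3 * f.d * p * q * s ^ 2
      + 3 * f.d * q ^ 2 * r * s + 6 * f.e * q ^ 2 * s ^ 2,
    4 * f.a * p * r ^ 3 + 3 * f.b * p * r ^ 2 * s + f.b * q * r ^ 3 + 2 * f.c * p * r * s ^ 2
      + 2 * f.c * q * r ^ 2 * s + f.d * p * s ^ 3 + 3 * f.d * q * r * s ^ 2 + 4 * f.e * q * s ^ 3,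
    f.a * r ^ 4 + f.b * r ^ 3 * s + f.c * r ^ 2 * s ^ 2 + f.d * r * s ^ 3 + f.e * s ^ 4⟩

/-- `(f.subst γ)(x,y) = f((x,y)γ)` with `(x,y)γ = (x γ₀₀ + y γ₁₀, x γ₀₁ + y γ₁₁)`
(Bhargava–Shankar 2015, §2 p. 8). [cite: BhargavaShankarAnnals2015, §2 p. 8] -/
theorem eval_subst (f : BinaryQuartic R) (γ : Matrix (Fin 2) (Fin 2) R) (x y : R) :
    (f.subst γ).eval x y = f.eval (x * γ 0 0 + y * γ 1 0) (x * γ 0 1 + y * γ 1 1) := by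
  simp only [subst, eval]
  ring

/-- The identity matrix acts trivially. [folklore] -/
@[simp] theorem subst_one (f : BinaryQuartic R) : f.subst 1 = f := by
  ext <;> simp [subst]

/-- The substitution action is a left action: `f.subst (γ₁ γ₂) = (f.subst γ₂).subst γ₁`, i.e.
`(γ₁γ₂) · f = γ₁ · (γ₂ · f)` (Bhargava–Shankar 2015, §2 p. 8).
[cite: BhargavaShankarAnnals2015, §2 p. 8] -/
theorem subst_mul (f : BinaryQuartic R) (γ₁ γ₂ : Matrix (Fin 2) (Fin 2) R) :
    f.subst (γ₁ * γ₂) = (f.subst γ₂).subst γ₁ := by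
  ext <;> simp only [subst, Matrix.mul_apply, Fin.sum_univ_two] <;> ring

/-- Scaling commutes with substitution. [folklore] -/
theorem smul_subst (μ : R) (f : BinaryQuartic R) (γ : Matrix (Fin 2) (Fin 2) R) :
    (μ • f).subst γ = μ • f.subst γ := by
  ext <;> simp only [subst, smul_a, smul_b, smul_c, smul_d, smul_e] <;> ring

/-- `map` commutes with substitution. [folklore] -/
theorem map_subst (φ : R →+* S) (f : BinaryQuartic R) (γ : Matrix (Fin 2) (Fin 2) R) :
    (f.subst γ).map φ = (f.map φ).subst (γ.map φ) := by
  ext <;> simp only [subst, map, Matrix.map_apply, map_add, map_mul, map_pow, map_ofNat]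

/-- Relative invariance of `I`: `I(γ · f) = (det γ)⁴ I(f)` (Bhargava–Shankar 2015, §2, p. 8).
[cite: BhargavaShankarAnnals2015, §2 p. 8 (relative invariants I, J)] -/
theorem I_subst (f : BinaryQuartic R) (γ : Matrix (Fin 2) (Fin 2) R) :
    (f.subst γ).I = γ.det ^ 4 * f.I := by
  simp only [subst, I, Matrix.det_fin_two]
  ring

/-- Relative invariance of `J`: `J(γ · f) = (det γ)⁶ J(f)` (Bhargava–Shankar 2015, §2, p. 8).
[cite: BhargavaShankarAnnals2015, §2 p. 8 (relative invariants I, J)] -/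
theorem J_subst (f : BinaryQuartic R) (γ : Matrix (Fin 2) (Fin 2) R) :
    (f.subst γ).J = γ.det ^ 6 * f.J := by
  simp only [subst, J, Matrix.det_fin_two]
  ring

/-- `I(μ f) = μ² I(f)` (elementary). [folklore] -/
theorem I_smul (μ : R) (f : BinaryQuartic R) : (μ • f).I = μ ^ 2 * f.I := by
  simp only [I, smul_a, smul_b, smul_c, smul_d, smul_e]; ring

/-- `J(μ f) = μ³ J(f)` (elementary). [folklore] -/
theorem J_smul (μ : R) (f : BinaryQuartic R) : (μ • f).J = μ ^ 3 * f.J := by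
  simp only [J, smul_a, smul_b, smul_c, smul_d, smul_e]; ring

/-! ### Solubility -/

/-- `f` is `K`-soluble: the equation `z² = f(x,y)` has a solution in `K` with `(x,y) ≠ (0,0)`
(Bhargava–Shankar 2015, §5.2 of the held arXiv text: "a binary quartic form `f` over `K` is
called `K`-soluble if the equation `z² = f(x,y)` has a solution in `K`"; the trivial solution
`x = y = z = 0` is excluded, as the solutions are points of the curve `z² = f(x,y)`).
[cite: BhargavaShankarAnnals2015, §5.2 (K-soluble forms; arXiv:1006.1002v2 numbering)] -/
def IsSoluble {K : Type*} [CommRing K] (f : BinaryQuartic K) : Prop :=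
  ∃ x y z : K, (x ≠ 0 ∨ y ≠ 0) ∧ z ^ 2 = f.eval x y

end CommRing

/-! ### Equivalences -/

/-- `GL₂(ℤ)`-equivalence of integral binary quartic forms: `g = γ · f` for some `γ ∈ GL₂(ℤ)`
(an integral matrix with unit determinant), for the substitution action `subst`
(Bhargava–Shankar 2015, §2: "`GL₂(ℤ)`-equivalence classes"). [cite: BhargavaShankarAnnals2015, §2 (GL₂(ℤ)-classes)] -/
def GL2ZEquiv (f g : BinaryQuartic ℤ) : Prop :=
  ∃ γ : Matrix (Fin 2) (Fin 2) ℤ, IsUnit γ.det ∧ g = f.subst γ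

/-- `GL₂(ℤ)`-equivalence is reflexive. [folklore] -/
theorem GL2ZEquiv.refl (f : BinaryQuartic ℤ) : GL2ZEquiv f f :=
  ⟨1, by simp, by simp⟩

/-- `GL₂(ℤ)`-equivalence is transitive. [folklore] -/
theorem GL2ZEquiv.trans {f g h : BinaryQuartic ℤ} (h₁ : GL2ZEquiv f g) (h₂ : GL2ZEquiv g h) :
    GL2ZEquiv f h := by
  obtain ⟨γ₁, hγ₁, rfl⟩ := h₁
  obtain ⟨γ₂, hγ₂, rfl⟩ := h₂
  exact ⟨γ₂ * γ₁, by rw [Matrix.det_mul]; exact hγ₂.mul hγ₁, (subst_mul f γ₂ γ₁).symm⟩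

/-- `GL₂(ℤ)`-equivalence is symmetric (the inverse of an integral matrix with unit determinant is
integral). [folklore] -/
theorem GL2ZEquiv.symm {f g : BinaryQuartic ℤ} (h : GL2ZEquiv f g) : GL2ZEquiv g f := by
  obtain ⟨γ, hγ, rfl⟩ := h
  refine ⟨γ⁻¹, Matrix.isUnit_nonsing_inv_det_iff.mpr hγ, ?_⟩
  rw [← subst_mul, Matrix.nonsing_inv_mul γ hγ, subst_one]

/-- `GL₂(ℤ)`-equivalence is an equivalence relation. [folklore] -/
theorem GL2ZEquiv.equivalence : Equivalence GL2ZEquiv :=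
  ⟨GL2ZEquiv.refl, GL2ZEquiv.symm, GL2ZEquiv.trans⟩

/-- The `GL₂(ℤ)`-orbit (equivalence class) of an integral form. [folklore] -/
def gl2zOrbit (f : BinaryQuartic ℤ) : Set (BinaryQuartic ℤ) :=
  {g | GL2ZEquiv f g}

/-- `PGL₂(K)`-equivalence of binary quartic forms over a field `K`, for the *twisted* action
`γ · f(x,y) = det(γ)⁻² f((x,y)γ)` of `GL₂(K)`, under which the centre acts trivially and `I`, `J`
are invariant (Bhargava–Shankar, held arXiv text §3.3 p. 15 and §5.1).
[cite: BhargavaShankarAnnals2015, §3.3 p. 15 (twisted action; arXiv:1006.1002v2 numbering)] -/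
def PGL2Equiv {K : Type*} [Field K] (f g : BinaryQuartic K) : Prop :=
  ∃ γ : Matrix (Fin 2) (Fin 2) K, γ.det ≠ 0 ∧ g = (γ.det ^ 2)⁻¹ • f.subst γ

/-- `K`-equivalence of binary quartic forms over a field `K`: `g = μ² (γ · f)` for some `μ ∈ Kˣ`
and `γ ∈ GL₂(K)` (Bhargava–Shankar, held arXiv text §5.1, before Lemma 5.2; for forms with the
same invariants it coincides with `PGL₂(K)`-equivalence, proof of Thm 5.6).
[cite: BhargavaShankarAnnals2015, §5.1 (K-equivalence; arXiv:1006.1002v2 numbering)] -/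
def KEquiv {K : Type*} [Field K] (f g : BinaryQuartic K) : Prop :=
  ∃ μ : K, μ ≠ 0 ∧ ∃ γ : Matrix (Fin 2) (Fin 2) K, γ.det ≠ 0 ∧ g = μ ^ 2 • f.subst γ

/-- A `PGL₂(K)`-equivalence is a `K`-equivalence (with `μ = det(γ)⁻¹`). [folklore] -/
theorem PGL2Equiv.kEquiv {K : Type*} [Field K] {f g : BinaryQuartic K} (h : PGL2Equiv f g) :
    KEquiv f g := by
  obtain ⟨γ, hγ, rfl⟩ := h
  exact ⟨γ.det⁻¹, inv_ne_zero hγ, γ, hγ, by rw [inv_pow]⟩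

/-- `PGL₂(K)`-equivalence is reflexive. [folklore] -/
theorem PGL2Equiv.refl {K : Type*} [Field K] (f : BinaryQuartic K) : PGL2Equiv f f :=
  ⟨1, by simp, by simp⟩

/-- `PGL₂(K)`-equivalence is symmetric. [folklore] -/
theorem PGL2Equiv.symm {K : Type*} [Field K] {f g : BinaryQuartic K} (h : PGL2Equiv f g) :
    PGL2Equiv g f := by
  obtain ⟨γ, hγ, rfl⟩ := h
  have hγu : IsUnit γ.det := isUnit_iff_ne_zero.mpr hγ
  refine ⟨γ⁻¹, ?_, ?_⟩
  · exact isUnit_iff_ne_zero.mp (Matrix.isUnit_nonsing_inv_det_iff.mpr hγu)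
  · rw [smul_subst, ← subst_mul, Matrix.nonsing_inv_mul γ hγu, subst_one, smul_smul,
      Matrix.det_nonsing_inv, Ring.inverse_eq_inv', inv_pow, inv_inv, mul_inv_cancel₀
        (pow_ne_zero 2 hγ), one_smul]

/-- `PGL₂(K)`-equivalence is transitive. [folklore] -/
theorem PGL2Equiv.trans {K : Type*} [Field K] {f g h : BinaryQuartic K} (h₁ : PGL2Equiv f g)
    (h₂ : PGL2Equiv g h) : PGL2Equiv f h := by
  obtain ⟨γ₁, hγ₁, rfl⟩ := h₁
  obtain ⟨γ₂, hγ₂, rfl⟩ := h₂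
  refine ⟨γ₂ * γ₁, by rw [Matrix.det_mul]; exact mul_ne_zero hγ₂ hγ₁, ?_⟩
  rw [smul_subst, smul_smul, subst_mul, Matrix.det_mul, mul_pow, mul_inv]

/-- The twisted action preserves `I`: `PGL₂(K)`-equivalent forms have the same `I`
(Bhargava–Shankar, held arXiv text §3.3: "the quantities `I` and `J` remain invariant under this
action"). [cite: BhargavaShankarAnnals2015, §3.3 p. 15 (arXiv:1006.1002v2 numbering)] -/
theorem PGL2Equiv.I_eq {K : Type*} [Field K] {f g : BinaryQuartic K} (h : PGL2Equiv f g) :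
    g.I = f.I := by
  obtain ⟨γ, hγ, rfl⟩ := h
  rw [I_smul, I_subst, ← mul_assoc, inv_pow, ← pow_mul,
    inv_mul_cancel₀ (pow_ne_zero _ hγ), one_mul]

/-- The twisted action preserves `J`: `PGL₂(K)`-equivalent forms have the same `J`
(Bhargava–Shankar, held arXiv text §3.3). [cite: BhargavaShankarAnnals2015, §3.3 p. 15 (arXiv:1006.1002v2 numbering)] -/
theorem PGL2Equiv.J_eq {K : Type*} [Field K] {f g : BinaryQuartic K} (h : PGL2Equiv f g) :
    g.J = f.J := by
  obtain ⟨γ, hγ, rfl⟩ := h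
  rw [J_smul, J_subst, ← mul_assoc, inv_pow, ← pow_mul,
    inv_mul_cancel₀ (pow_ne_zero _ hγ), one_mul]

/-! ### Integral forms: height, real type, irreducibility, local solubility, class counts -/

section Integral

/-- The height `H(I,J) = max(|I|³, J²/4)` of a pair of invariants (Bhargava–Shankar 2015, §1.2
and §2 p. 8). [cite: BhargavaShankarAnnals2015, §2 p. 8] -/
def heightIJ (I J : ℤ) : ℝ :=
  max (|(I : ℝ)| ^ 3) ((J : ℝ) ^ 2 / 4)

/-- The height `H(f) = H(I(f), J(f)) = max(|I(f)|³, J(f)²/4)` of an integral binary quartic form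
(Bhargava–Shankar 2015, §2 p. 8). [cite: BhargavaShankarAnnals2015, §2 p. 8] -/
def height (f : BinaryQuartic ℤ) : ℝ :=
  heightIJ f.I f.J

/-- The height is a `GL₂(ℤ)`-invariant (`I`, `J` are invariant under matrices of determinant
`±1`). [cite: BhargavaShankarAnnals2015, §2 (I, J invariant under SL₂^±)] -/
theorem height_subst_of_isUnit (f : BinaryQuartic ℤ) {γ : Matrix (Fin 2) (Fin 2) ℤ}
    (hγ : IsUnit γ.det) : (f.subst γ).height = f.height := by
  have h2 : γ.det ^ 2 = 1 := by
    rcases Int.isUnit_iff.mp hγ with h | h <;> simp [h]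
  have h4 : γ.det ^ 4 = 1 := by rw [show (4 : ℕ) = 2 * 2 from rfl, pow_mul, h2, one_pow]
  have h6 : γ.det ^ 6 = 1 := by rw [show (6 : ℕ) = 2 * 3 from rfl, pow_mul, h2, one_pow]
  simp [height, I_subst, J_subst, h4, h6]

/-- A real binary quartic form is *definite* if it takes only positive or only negative values at
nonzero vectors (Bhargava–Shankar 2015, §2.1). [cite: BhargavaShankarAnnals2015, §2.1 (definite forms)] -/
def IsDefinite (f : BinaryQuartic ℝ) : Prop :=
  (∀ x y : ℝ, (x ≠ 0 ∨ y ≠ 0) → 0 < f.eval x y) ∨ (∀ x y : ℝ, (x ≠ 0 ∨ y ≠ 0) → f.eval x y < 0)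

/-- `V_ℤ^{(0)}`: integral forms with four (distinct) real roots in `ℙ¹(ℝ)`, i.e. `Δ > 0` and `f`
not definite: for `Δ > 0` the roots are either all real or form two complex-conjugate pairs, and in
the latter case `f` has no zero on `ℝ² ∖ {0}`, hence constant sign (Bhargava–Shankar 2015, §2.1:
for `4I³ − J² > 0` the real forms with given invariants form the orbits `V_ℝ^{(0)}`, `V_ℝ^{(2+)}`,
`V_ℝ^{(2−)}`, the latter two definite). [cite: BhargavaShankarAnnals2015, §2.1] -/
def fourRealRoots : Set (BinaryQuartic ℤ) :=
  {f | 0 < f.disc ∧ ¬ (f.map (Int.castRingHom ℝ)).IsDefinite}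

/-- `V_ℤ^{(1)}`: integral forms with exactly two real roots in `ℙ¹(ℝ)`, i.e. `Δ < 0` (one pair
of complex-conjugate roots) (Bhargava–Shankar 2015, §2.1, fact 1: for `4I³ − J² < 0` there is a
single real orbit, lying in `V_ℝ^{(1)}`). [cite: BhargavaShankarAnnals2015, §2.1] -/
def twoRealRoots : Set (BinaryQuartic ℤ) :=
  {f | f.disc < 0}

/-- `V_ℤ^{(2)}`: integral forms with no real roots in `ℙ¹(ℝ)`, i.e. the definite forms
(Bhargava–Shankar 2015, §2.1: "`V_ℝ^{(2)}` is the set of definite forms"; such a form with distinct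
roots has `Δ > 0`). [cite: BhargavaShankarAnnals2015, §2.1] -/
def noRealRoots : Set (BinaryQuartic ℤ) :=
  {f | (f.map (Int.castRingHom ℝ)).IsDefinite}

/-- An integral binary quartic form is *irreducible* (over `ℚ`, as a binary form) iff `a ≠ 0` and
`f(x,1)` is irreducible in `ℚ[X]`: a form with `a = 0` is divisible by `y`, and for `a ≠ 0` the
factorisations of `f(x,y)` into binary forms over `ℚ` correspond to those of `f(x,1)`
(Bhargava–Shankar 2015, §2: "irreducible elements `f ∈ S`"). [cite: BhargavaShankarAnnals2015, §2 (Thm 2.1, irreducible integral forms)] -/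
def IsIrreducible (f : BinaryQuartic ℤ) : Prop :=
  f.a ≠ 0 ∧ Irreducible (f.map (Int.castRingHom ℚ)).toPoly

/-- An integral binary quartic form is *locally soluble* if `z² = f(x,y)` has a (nontrivial)
solution over `ℝ` and over `ℚ_p` for every prime `p` (Bhargava–Shankar, held arXiv text §5.1).
[cite: BhargavaShankarAnnals2015, §5.1 (locally soluble forms; arXiv:1006.1002v2 numbering)] -/
def IsLocallySoluble (f : BinaryQuartic ℤ) : Prop :=
  (f.map (Int.castRingHom ℝ)).IsSoluble ∧
    ∀ (p : ℕ) [Fact p.Prime], (f.map (Int.castRingHom ℚ_[p])).IsSoluble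

/-- `N(S; X)`: the number of `GL₂(ℤ)`-equivalence classes of irreducible integral binary quartic
forms `f ∈ S` with `H(f) < X`, for a (`GL₂(ℤ)`-invariant) set `S ⊆ V_ℤ` — the `Set.ncard` of the
set of orbits met (finite by Borel–Harish-Chandra; junk value `0` if infinite)
(Bhargava–Shankar 2015, Thm 2.1). [cite: BhargavaShankarAnnals2015, Thm 2.1 (definition of N(S;X))] -/
def gl2zClassCount (S : Set (BinaryQuartic ℤ)) (X : ℝ) : ℕ :=
  (gl2zOrbit '' {f | f ∈ S ∧ f.IsIrreducible ∧ f.height < X}).ncard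

/-- The number of `PGL₂(ℚ)`-equivalence classes met by a set `S` of integral binary quartic forms
(forms compared in `V_ℚ` under the twisted action) — `Set.ncard` of the set of traces on `S` of
the classes (Bhargava–Shankar, held arXiv text, Thm 5.6 and §5.2).
[cite: BhargavaShankarAnnals2015, Thm 5.6 (arXiv:1006.1002v2 numbering)] -/
def pgl2QClassCount (S : Set (BinaryQuartic ℤ)) : ℕ :=
  ((fun f ↦ {g | g ∈ S ∧ PGL2Equiv (f.map (Int.castRingHom ℚ)) (g.map (Int.castRingHom ℚ))}) ''
    S).ncard

end Integral

end BinaryQuartic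

/-! ### Named facts (Bhargava–Shankar 2015) -/

open BinaryQuartic

/-- **Bhargava–Shankar, Thm 1.6 (= Thm 2.1)** (Ann. of Math. 181 (2015), §1.2 and §2). Let
`h^{(i)}(I,J)` be the number of `GL₂(ℤ)`-equivalence classes of irreducible integral binary
quartic forms having `4 − 2i` real roots in `ℙ¹` and invariants `I`, `J`; equivalently let
`N(V_ℤ^{(i)}; X)` count the classes of irreducible `f ∈ V_ℤ^{(i)}` with `H(f) < X`. Then
`N(V_ℤ^{(0)}; X) = (4/135) ζ(2) X^{5/6} + O(X^{3/4+ε})`,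
`N(V_ℤ^{(1)}; X) = (32/135) ζ(2) X^{5/6} + O(X^{3/4+ε})`,
`N(V_ℤ^{(2)}; X) = (8/135) ζ(2) X^{5/6} + O(X^{3/4+ε})`, with `ζ(2) = π²/6`; here for every
`ε > 0` the error is bounded by `C_ε X^{3/4+ε}` for all `X ≥ 1`.
[cite: BhargavaShankarAnnals2015, Thm 1.6 and Thm 2.1] -/
def bhargavaShankar_classCount : Prop :=
  ∀ ε : ℝ, 0 < ε → ∃ C : ℝ, ∀ X : ℝ, 1 ≤ X →
    |(gl2zClassCount fourRealRoots X : ℝ) - 4 / 135 * (Real.pi ^ 2 / 6) * X ^ (5 / 6 : ℝ)|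
        ≤ C * X ^ (3 / 4 + ε) ∧
      |(gl2zClassCount twoRealRoots X : ℝ) - 32 / 135 * (Real.pi ^ 2 / 6) * X ^ (5 / 6 : ℝ)|
        ≤ C * X ^ (3 / 4 + ε) ∧
      |(gl2zClassCount noRealRoots X : ℝ) - 8 / 135 * (Real.pi ^ 2 / 6) * X ^ (5 / 6 : ℝ)|
        ≤ C * X ^ (3 / 4 + ε)

/-- **Bhargava–Shankar, Thm 1.7** (Ann. of Math. 181 (2015), §1.2). A pair `(I, J) ∈ ℤ × ℤ`
occurs as the invariants of an integral binary quartic form if and only if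
(a) `I ≡ 0 (mod 3)` and `J ≡ 0 (mod 27)`, or (b) `I ≡ 1 (mod 9)` and `J ≡ ±2 (mod 27)`, or
(c) `I ≡ 4 (mod 9)` and `J ≡ ±16 (mod 27)`, or (d) `I ≡ 7 (mod 9)` and `J ≡ ±7 (mod 27)`.
[cite: BhargavaShankarAnnals2015, Thm 1.7] -/
def bhargavaShankar_eligible_iff : Prop :=
  ∀ I J : ℤ, (∃ f : BinaryQuartic ℤ, f.I = I ∧ f.J = J) ↔
    (I ≡ 0 [ZMOD 3] ∧ J ≡ 0 [ZMOD 27]) ∨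
      (I ≡ 1 [ZMOD 9] ∧ (J ≡ 2 [ZMOD 27] ∨ J ≡ -2 [ZMOD 27])) ∨
      (I ≡ 4 [ZMOD 9] ∧ (J ≡ 16 [ZMOD 27] ∨ J ≡ -16 [ZMOD 27])) ∨
      (I ≡ 7 [ZMOD 9] ∧ (J ≡ 7 [ZMOD 27] ∨ J ≡ -7 [ZMOD 27]))

/-- **Bhargava–Shankar, `2`-Selmer parametrization** (held arXiv text `arXiv:1006.1002`, Thm 5.6,
from Birch–Swinnerton-Dyer, *Notes on elliptic curves I*, Lemmas 3–5 = Lemmas 5.3–5.5 there; in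
the published version this is the parametrization theorem of its §3). Let `E = E_{A,B} : y² = x³ +
Ax + B` with `(A, B)` in the height family (`4A³ + 27B² ≠ 0`, `p⁴ ∤ A` or `p⁶ ∤ B` for every `p`)
and put `I(E) = −3A`, `J(E) = −27B` (§5, p. 31). Then the elements of the `2`-Selmer group of `E`
are in one-to-one correspondence with the `PGL₂(ℚ)`-equivalence classes of locally soluble
integral binary quartic forms having invariants `2⁴ I(E)` and `2⁶ J(E)`; rendered as an equality
of cardinalities, the Selmer group being the tree's cohomological
`WeierstrassCurve.selmerGroup _ 2`. [cite: BhargavaShankarAnnals2015, Thm 5.6 (arXiv:1006.1002v2 numbering; §5.1)] -/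
def bhargavaShankar_card_selmerTwo_eq : Prop :=
  ∀ AB : ℤ × ℤ, IsInHeightFamily AB →
    Nat.card ((shortWeierstrass AB).selmerGroup 2) =
      pgl2QClassCount {f : BinaryQuartic ℤ | f.IsLocallySoluble ∧
        f.I = 2 ^ 4 * (-3 * AB.1) ∧ f.J = 2 ^ 6 * (-27 * AB.2)}

end Literature.NumberTheory.EllipticCurves

end
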